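import Summits.KontsevichZagierPeriods.Zeta5Search.TwoTaleD1Measure
import Summits.KontsevichZagierPeriods.Zeta5Search.TwoTaleL720Measure
import Mathlib.Analysis.Real.Pi.Irrational
import HarnessLib

/-!
# A kernel irrationality exponent for `π` read off the tree's `μ(π²) ≤ 5.0205`: `μ(π) ≤ 10.041`

HONEST FRAMING: systematic search; no irrationality claim unless certified.  `π` is irrational (Mathlib,
`irrational_pi`); this file asserts nothing about `ζ(5)` and moves NO record: the irrationality measure of
record for `π` in print is `μ(π) ≤ 7.103205334137…` [Zeilberger–Zudilin 2020] (tree: the named statement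
`Literature.NumberTheory.Irrationality.ZeilbergerZudilin2020.pi_irrationalityExponent_le`), far BELOW the
number proved here, and the cell's paper-grade `7.1018628323564` (paper §M (M16), NOT kernel) is untouched.

What the file adds (cell pub-zeta5, row measure-1 = π measures, seat g4; criterion C4 comparison scale only):
* the TRANSFER LEMMA `liouvilleWith_sq`: for irrational `x` and `0 ≤ p`, `LiouvilleWith p x → LiouvilleWith (p/2) (x²)`
  (denominators `n ↦ n²`: `|x − m/n| < C/nᵖ` gives `|x² − m²/n²| = |x − m/n|·|x + m/n| < C(2|x|+C)/(n²)^{p/2}`), hence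
  `exponentLE_of_sq : ExponentLE (ξ²) κ → ExponentLE ξ (2κ)` — `μ(ξ) ≤ 2·μ(ξ²)`;
* its instance on the hypothesis-free kernel theorem `TwoTaleD1Measure.pi_sq_not_liouvilleWith_D1 :
  ∀ p > 5.0205, ¬ LiouvilleWith p (π²)` (rung D1 = L(1/3) of the two-tale ladder for `ζ(2) = π²/6`):
  `pi_exponent_le_D1 : ExponentLE Real.pi 10.041` (`2 · 5.0205 = 10.041`), i.e. `∀ p > 10.041, ¬ LiouvilleWith p π`.
This is the tree's first kernel statement of shape `ExponentLE Real.pi κ`; it is a COROLLARY of the `ζ(2)` rung, not a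
construction for `π`, and `MeasureRecords.pi_newRecord_of_exponentLE` (which needs `κ < 7.103205334137`) does NOT apply.
-/

namespace Summit.KontsevichZagierPeriods.Zeta5Search.PiExponentFromZetaTwo

open Filter

/-- Squares of Liouville numbers: if `x` is irrational and Liouville with exponent `p ≥ 0`, then `x²` is Liouville
with exponent `p/2` (approximate `x²` by `m²/n²`). -/
theorem liouvilleWith_sq {p x : ℝ} (hx : Irrational x) (hp : 0 ≤ p) (h : LiouvilleWith p x) :
    LiouvilleWith (p / 2) (x ^ 2) := by
  obtain ⟨C, hC0, hC⟩ := h.exists_pos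
  refine ⟨C * (2 * |x| + C), ?_⟩
  have ht : Tendsto (fun n : ℕ => n ^ 2) atTop atTop := tendsto_pow_atTop two_ne_zero
  refine ht.frequently (hC.mono ?_)
  rintro n ⟨hn, m, hne, hlt⟩
  have hn0 : (n : ℝ) ≠ 0 := Nat.cast_ne_zero.mpr (by omega)
  refine ⟨m ^ 2, ?_, ?_⟩
  · -- `x² ≠ m²/n²`, since `x` is irrational
    intro hsq
    have hcast : ((m ^ 2 : ℤ) : ℝ) / ((n ^ 2 : ℕ) : ℝ) = ((m : ℝ) / n) ^ 2 := by
      push_cast; ring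
    rw [hcast, sq_eq_sq_iff_eq_or_eq_neg] at hsq
    rcases hsq with h1 | h1
    · exact hne h1
    · exact hx.ne_rat (-(m : ℚ) / n) (by rw [h1]; push_cast; ring)
  · -- the inequality
    have hn1 : (1 : ℝ) ≤ n := by exact_mod_cast hn
    have hnp : (1 : ℝ) ≤ (n : ℝ) ^ p := Real.one_le_rpow hn1 hp
    have hnp0 : (0 : ℝ) < (n : ℝ) ^ p := lt_of_lt_of_le one_pos hnp
    have hCnp : C / (n : ℝ) ^ p ≤ C := by
      rw [div_le_iff₀ hnp0]; nlinarith
    have hsum : |x + m / n| ≤ 2 * |x| + C := by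
      have e : x + (m : ℝ) / n = 2 * x - (x - m / n) := by ring
      have : |x + (m : ℝ) / n| ≤ |2 * x| + |x - m / n| := by rw [e]; exact abs_sub _ _
      rw [abs_mul, abs_two] at this
      linarith [hlt.le.trans hCnp]
    have key : |x ^ 2 - ((m ^ 2 : ℤ) : ℝ) / ((n ^ 2 : ℕ) : ℝ)| = |x - m / n| * |x + m / n| := by
      rw [← abs_mul]; congr 1; push_cast; ring
    have hpow : (((n ^ 2 : ℕ) : ℝ)) ^ (p / 2) = (n : ℝ) ^ p := by
      push_cast
      rw [← Real.rpow_natCast (n : ℝ) 2, ← Real.rpow_mul (Nat.cast_nonneg n)]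
      congr 1; push_cast; ring
    rw [key, hpow]
    calc |x - m / n| * |x + m / n| ≤ |x - m / n| * (2 * |x| + C) := by gcongr
      _ < C / (n : ℝ) ^ p * (2 * |x| + C) := mul_lt_mul_of_pos_right hlt (by positivity)
      _ = C * (2 * |x| + C) / (n : ℝ) ^ p := by ring

/-- **`μ(ξ) ≤ 2·μ(ξ²)`** for irrational `ξ`: an exponent bound for `ξ²` transfers to `ξ` with a factor `2`. -/
theorem exponentLE_of_sq {ξ κ : ℝ} (hξ : Irrational ξ) (hκ : 0 ≤ κ) (h : ExponentLE (ξ ^ 2) κ) :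
    ExponentLE ξ (2 * κ) := by
  intro p hp hL
  exact h (p / 2) (by linarith) (liouvilleWith_sq hξ (by linarith) hL)

/-- The `π` instance of the transfer: any kernel bound `μ(π²) ≤ κ` gives `μ(π) ≤ 2κ`. -/
theorem pi_exponent_le_of_pi_sq {κ : ℝ} (hκ : 0 ≤ κ) (h : ExponentLE (Real.pi ^ 2) κ) :
    ExponentLE Real.pi (2 * κ) :=
  exponentLE_of_sq irrational_pi hκ h

/-- **`μ(π) ≤ 10.041`, hypothesis-free** (`= 2 · 5.0205` from the tree's rung D1 `μ(π²) ≤ 5.0205`,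
`TwoTaleD1Measure.pi_sq_not_liouvilleWith_D1`).  NOT a record: print has `μ(π) ≤ 7.103205334137…`
[Zeilberger–Zudilin 2020]; comparison scale for criterion C4 only. -/
theorem pi_exponent_le_D1 : ExponentLE Real.pi 10.041 := by
  have h : ExponentLE (Real.pi ^ 2) 5.0205 := TwoTaleD1Measure.pi_sq_not_liouvilleWith_D1
  exact (pi_exponent_le_of_pi_sq (by norm_num) h).mono (by norm_num)

/-- Mathlib-terms restatement: for every real `p > 10.041`, `π` is not Liouville with exponent `p`. -/
theorem pi_not_liouvilleWith_D1 : ∀ p : ℝ, (10.041 : ℝ) < p → ¬ LiouvilleWith p Real.pi :=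
  pi_exponent_le_D1

/-!
## Update at rung L(7/20) (append, measure-opt g3, 2026-08-26): `μ(π) ≤ 10.0388`

The same transfer applied to the two-tale ladder's optimal four-decimal rung
`TwoTaleL720Measure.pi_sq_not_liouvilleWith_L720 : ∀ p > 5.0194, ¬ LiouvilleWith p (π²)` (measure-opt g0, p412423;
`TwoTaleL720Measure.zetaTwo_exponent_le_L720 : ExponentLE (zetaValue 2) 5.0194`): `2 · 5.0194 = 10.0388`.
HONEST FRAMING: a corollary for the known-irrational (indeed transcendental) `π`, far ABOVE the printed record
`μ(π) ≤ 7.103205334137…` [Zeilberger–Zudilin 2020] and the cell's paper-grade `7.1018628…` (NOT kernel); criterion C4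
comparison scale only; NOT a record; `MeasureRecords.pi_newRecord_of_exponentLE` does NOT apply; nothing about `ζ(5)`.
-/

/-- **`μ(π) ≤ 10.0388`, hypothesis-free** (`= 2 · 5.0194` from the tree's rung L(7/20) `μ(π²) ≤ 5.0194`,
`TwoTaleL720Measure.pi_sq_not_liouvilleWith_L720`).  NOT a record: print has `μ(π) ≤ 7.103205334137…`
[Zeilberger–Zudilin 2020]; comparison scale for criterion C4 only. -/
theorem pi_exponent_le_L720 : ExponentLE Real.pi 10.0388 := by
  have h : ExponentLE (Real.pi ^ 2) 5.0194 := TwoTaleL720Measure.pi_sq_not_liouvilleWith_L720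
  exact (pi_exponent_le_of_pi_sq (by norm_num) h).mono (by norm_num)

/-- Mathlib-terms restatement: for every real `p > 10.0388`, `π` is not Liouville with exponent `p`. -/
theorem pi_not_liouvilleWith_L720 : ∀ p : ℝ, (10.0388 : ℝ) < p → ¬ LiouvilleWith p Real.pi :=
  pi_exponent_le_L720

/-- The two kernel bounds for `μ(π)` side by side: the L(7/20) corollary sharpens the D1 corollary
(`10.0388 < 10.041`). -/
theorem pi_exponent_le_L720_and_D1 :
    ExponentLE Real.pi 10.0388 ∧ ExponentLE Real.pi 10.041 ∧ (10.0388 : ℝ) < 10.041 :=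
  ⟨pi_exponent_le_L720, pi_exponent_le_D1, by norm_num⟩

end Summit.KontsevichZagierPeriods.Zeta5Search.PiExponentFromZetaTwo
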